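import Mathlib
import Summits.NavierStokesRegularity.NavierStokesRegularity.Theorems.DssFarFieldSlavingBlowupTypeIDssProfileSimilarityEnstrophyLambThreshold
import HarnessLib

/-!
# The CROSS-FLOW FLOOR: a Type-I ancient mild field whose velocity component ACROSS the vorticity
  is sub-critical on the vortex set is trivial — `√(−t)‖ω × V‖ ≤ θ‖ω‖` with `θ < 1` ⇒ `V ≡ 0`
  (pub-ns-dss, route `DssFarFieldSlaving`, crux `BlowupTypeIDssProfile`,
  stmt-NavierStokesRegularity-0155 — SUPPORT; typer seat g20, 2026-08-26)

HONEST FRAMING. Exclusion statements about a HYPOTHETICAL object (a Type-I ancient mild solution in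
the Koch–Nadirashvili–Seregin–Šverák gauge, `IsTypeIAncientMild C₀ V`, with the space–time envelope
`HasTypeIDecay C₀ V` at the classical level; the hypothesis class of `RdssProfileTruncation` at the
class level). Nothing asserts the hypothesis for any given field; `1` is the threshold of the
argument and nothing is said at or above it; nothing numerical; census words on ACCEPT, if any, are
the lead's; nothing here bears on Navier–Stokes regularity or blow-up.

THE STATEMENT. Write `U = lerayOrbit V`, `Ω = lerayVorticity V` (similarity variables) and
`ω = curl V(t)` (physical variables). If `‖Ω(s,y) × U(s,y)‖ ≤ θ‖Ω(s,y)‖` for all `s, y` — equivalently,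
by the KNSS scaling, `√(−t)·‖ω(t,x) × V(t,x)‖ ≤ θ‖ω(t,x)‖` for all `t < 0`, `x`; equivalently, the
component `U_⊥` of the similarity velocity perpendicular to the vorticity has `‖U_⊥‖ ≤ θ` wherever
`Ω ≠ 0` — and `θ < 1`, then `V ≡ 0` (`typeI_ancient_eq_zero_of_crossFlow_lt_one`). Portrait reading:
every non-trivial field of the class has CROSS-FLOW constant `sup_{Ω ≠ 0} ‖U_⊥‖ ≥ 1`, which sharpens
the time-constant floor `sup ‖U‖ ≥ 1` of Row 2′ / T31⁗ (`crossFlow_of_timeConstant`: `‖ω × V‖ ≤ ‖ω‖‖V‖`)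
and contains the endpoint «`V` parallel to `ω` on the vortex set» (`θ = 0`; compare the
generalised-Beltrami endpoint `curl (ω × V) ≡ 0` of `…SimilarityEnstrophyBeltramiLiouville`, which is a
different hypothesis). At CLASS level (`rdssClass_empty_of_crossFlow`): for every Type-I level `M` and
every `θ < 1` the cell «all KNSS-gauge representatives have cross-flow constant `≤ θ`» is EMPTY,
UNCONDITIONALLY (the class carries `HasTypeIDecay M`).

THE MECHANISM is the Λ-directional one of `…SimilarityEnstrophyLambThreshold` (T49) with ONE inequality
removed: the proof of `integral_stretching_le_of_lambDirection` bounds `‖Ω × curl Ω‖ ≤ ‖Ω‖‖curl Ω‖` at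
once, so the Λ-floor holds under the WEAKER product hypothesis `⟪U, Ω × curl Ω⟫ ≤ θ‖Ω‖‖curl Ω‖`
(`integral_stretching_le_of_lambProduct`, `typeI_ancient_eq_zero_of_lambProduct_lt_one_sim`: Lamb form
of the stretching `Str = ∫⟪U, Ω × curl Ω⟫`, pointwise Young `θbc ≤ c² + (θ²/4)b²`, the whole-space
div–curl identity `∫‖curl Ω‖² = ∫|∇Ω|²_F`, and the tree's funnel `typeI_ancient_eq_zero_of_stretching_le`
with `β = θ²/4 < ¼`); and the cross-flow hypothesis implies the product hypothesis by the scalar triple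
product, `⟪U, Ω × curl Ω⟫ = −⟪Ω × U, curl Ω⟫ ≤ ‖Ω × U‖‖curl Ω‖` (`inner_lamb_le_of_crossFlow`). The
Λ-directional hypothesis of T49 also implies the product hypothesis (`lambProduct_of_lambDirection`), so
T49′ ⊇ T49 ∪ {cross-flow} ⊇ Row 2′.
-/

noncomputable section

set_option linter.dupNamespace false

namespace Summit.NavierStokesRegularity.NavierStokesRegularity.Theorems.SimilarityEnstrophy

open MeasureTheory Set Filter Topology Module Metric InnerProductSpace Function
open scoped RealInnerProductSpace Laplacian ContDiff
open Literature.Analysis Literature.Analysis.FluidPDE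
open Summit.NavierStokesRegularity.NavierStokesRegularity.Theorems.GaussianGap
open Summit.NavierStokesRegularity.NavierStokesRegularity.Theorems

/-! ### T49′: the Λ-floor under the PRODUCT hypothesis `⟪U, Ω × curl Ω⟫ ≤ θ‖Ω‖‖curl Ω‖` -/

/-- **Stretching bound from the product hypothesis** (one slice): for a KNSS-gauge Type-I field under (D)
at `k = 1, 2`, if `⟪U(s,y), Ω × curl Ω (s,y)⟫ ≤ θ‖Ω(s,y)‖‖curl Ω(s,y)‖` for all `y` (any real `θ`), then
`Str(s) ≤ ∫|∇Ω(s)|²_F + (θ²/4) Z(s)`: Lamb form of the stretching, pointwise Young `θbc ≤ c² + (θ²/4)b²`,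
and `∫‖curl Ω‖² = ∫|∇Ω|²_F` (the proof of `integral_stretching_le_of_lambDirection` without its first
step `‖Ω × curl Ω‖ ≤ ‖Ω‖‖curl Ω‖`). [this file] -/
theorem integral_stretching_le_of_lambProduct {M : ℝ}
    {V : ℝ → EuclideanSpace ℝ (Fin 3) → EuclideanSpace ℝ (Fin 3)} (hV : IsTypeIAncientMild M V) {C₁ C₂ : ℝ}
    (hD1 : ∀ t < 0, ∀ x, (‖x‖ + Real.sqrt (-t)) ^ (1 + 1) * ‖iteratedFDeriv ℝ 1 (V t) x‖ ≤ C₁)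
    (hD2 : ∀ t < 0, ∀ x, (‖x‖ + Real.sqrt (-t)) ^ (2 + 1) * ‖iteratedFDeriv ℝ 2 (V t) x‖ ≤ C₂)
    {θ : ℝ} (s : ℝ)
    (hΛ : ∀ y : EuclideanSpace ℝ (Fin 3),
      ⟪lerayOrbit V s y, cross (lerayVorticity V s y) (curl (lerayVorticity V s) y)⟫ ≤
        θ * (‖lerayVorticity V s y‖ * ‖curl (lerayVorticity V s) y‖)) :
    ∫ y, ⟪lerayVorticity V s y, fderiv ℝ (lerayOrbit V s) y (lerayVorticity V s y)⟫ ≤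
      (∫ y, frobeniusNormSq (fderiv ℝ (lerayVorticity V s) y)) +
        (θ ^ 2 / 4) * ∫ y, ‖lerayVorticity V s y‖ ^ 2 := by
  have iC := integrable_norm_curl_lerayVorticity_sq hV hD2 s
  have iZ := integrable_norm_lerayVorticity_sq hV hD1 s
  have iΛ := integrable_inner_lerayOrbit_lamb hV hD1 hD2 s
  rw [integral_stretching_eq_integral_inner_lamb hV hD1 hD2 s,
    ← integral_norm_curl_lerayVorticity_sq_eq hV hD1 hD2 s, ← integral_const_mul,
    ← integral_add iC (iZ.const_mul _)]
  refine integral_mono iΛ (iC.add (iZ.const_mul _)) fun y => ?_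
  dsimp only
  have h2 : θ * (‖lerayVorticity V s y‖ * ‖curl (lerayVorticity V s) y‖) ≤
      ‖curl (lerayVorticity V s) y‖ ^ 2 + θ ^ 2 / 4 * ‖lerayVorticity V s y‖ ^ 2 := by
    nlinarith [sq_nonneg (‖curl (lerayVorticity V s) y‖ - θ * ‖lerayVorticity V s y‖ / 2)]
  linarith [hΛ y]

/-- **T49′, CLASSICAL, similarity variables, UNCONDITIONAL given the envelope.** A KNSS-gauge Type-I field `V`
(`IsTypeIAncientMild C₀ V`, any level `C₀`) with `HasTypeIDecay C₀ V` whose Leray orbit satisfies, for all `s, y`,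
`⟪U(s,y), Ω × curl Ω (s,y)⟫ ≤ θ‖Ω(s,y)‖‖curl Ω(s,y)‖` with `θ < 1`, vanishes on `t < 0`: gauge bounds (D) from
`IsTypeIAncientMild.gaugeBounds_of_hasTypeIDecay`, `integral_stretching_le_of_lambProduct` at `θ⁺ = max θ 0`,
and the tree's closing step `typeI_ancient_eq_zero_of_stretching_le` (`β = (θ⁺)²/4 < ¼`). Contains T49
(`lambProduct_of_lambDirection`) and the cross-flow floor (`inner_lamb_le_of_crossFlow`). [this file] -/
theorem typeI_ancient_eq_zero_of_lambProduct_lt_one_sim {C₀ θ : ℝ}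
    {V : ℝ → EuclideanSpace ℝ (Fin 3) → EuclideanSpace ℝ (Fin 3)} (hθ : θ < 1)
    (hV : IsTypeIAncientMild C₀ V) (hdec : HasTypeIDecay C₀ V)
    (hΛ : ∀ (s : ℝ) (y : EuclideanSpace ℝ (Fin 3)),
      ⟪lerayOrbit V s y, cross (lerayVorticity V s y) (curl (lerayVorticity V s) y)⟫ ≤
        θ * (‖lerayVorticity V s y‖ * ‖curl (lerayVorticity V s) y‖)) :
    ∀ t < 0, ∀ x, V t x = 0 := by
  obtain ⟨C₁, C₂, C₃, hD1, hD2, hD3⟩ := IsTypeIAncientMild.gaugeBounds_of_hasTypeIDecay hV hdec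
  have hθ'0 : 0 ≤ max θ 0 := le_max_right _ _
  have hθ'1 : max θ 0 < 1 := max_lt hθ one_pos
  have hsq : (max θ 0) ^ 2 < 1 := by nlinarith
  have hβ : (max θ 0) ^ 2 / 4 < 1 / 4 := by linarith
  refine typeI_ancient_eq_zero_of_stretching_le hV hD1 hD2 hD3 hβ fun s => ?_
  exact integral_stretching_le_of_lambProduct hV hD1 hD2 s fun y =>
    (hΛ s y).trans (mul_le_mul_of_nonneg_right (le_max_left _ _)
      (mul_nonneg (norm_nonneg _) (norm_nonneg _)))

/-- **T49 ⊂ T49′**: the Λ-directional hypothesis `⟪U, Λ⟫ ≤ θ‖Λ‖` (`Λ = Ω × curl Ω`, `0 ≤ θ`) implies the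
product hypothesis, by `‖Ω × curl Ω‖ ≤ ‖Ω‖‖curl Ω‖` (`norm_cross_le_norm_mul_norm`). [folklore] -/
theorem lambProduct_of_lambDirection {θ : ℝ} (hθ0 : 0 ≤ θ) (U Ω C : EuclideanSpace ℝ (Fin 3))
    (h : ⟪U, cross Ω C⟫ ≤ θ * ‖cross Ω C‖) : ⟪U, cross Ω C⟫ ≤ θ * (‖Ω‖ * ‖C‖) :=
  h.trans (mul_le_mul_of_nonneg_left (norm_cross_le_norm_mul_norm _ _) hθ0)

/-! ### The cross-flow hypothesis implies the product hypothesis -/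

/-- **The scalar triple product step**: `‖Ω × U‖ ≤ θ‖Ω‖` implies `⟪U, Ω × C⟫ ≤ θ‖Ω‖‖C‖` for every
vector `C` (`⟪U, Ω × C⟫ = −⟪Ω × U, C⟫ ≤ ‖Ω × U‖‖C‖`). [folklore] -/
theorem inner_lamb_le_of_crossFlow {θ : ℝ} (U Ω C : EuclideanSpace ℝ (Fin 3))
    (h : ‖cross Ω U‖ ≤ θ * ‖Ω‖) : ⟪U, cross Ω C⟫ ≤ θ * (‖Ω‖ * ‖C‖) := by
  have htriple : ⟪U, cross Ω C⟫ = -⟪cross Ω U, C⟫ := by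
    simp only [cross, PiLp.inner_apply, cross_apply, RCLike.inner_apply,
      conj_trivial, Fin.sum_univ_three, Matrix.cons_val_zero, Matrix.cons_val_one,
      Matrix.cons_val_two, Matrix.head_cons, Matrix.tail_cons]
    ring
  rw [htriple]
  calc -⟪cross Ω U, C⟫ ≤ ‖cross Ω U‖ * ‖C‖ :=
        (neg_le_abs _).trans ((abs_real_inner_le_norm _ _))
    _ ≤ θ * ‖Ω‖ * ‖C‖ := mul_le_mul_of_nonneg_right h (norm_nonneg _)
    _ = θ * (‖Ω‖ * ‖C‖) := by ring

/-! ### The cross-flow floor: CLASSICAL, similarity and physical variables -/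

/-- **The CROSS-FLOW FLOOR, CLASSICAL, similarity variables.** A KNSS-gauge Type-I field `V`
(`IsTypeIAncientMild C₀ V`, any `C₀`) with `HasTypeIDecay C₀ V` whose Leray orbit satisfies
`‖Ω(s,y) × U(s,y)‖ ≤ θ‖Ω(s,y)‖` for all `s, y` (the velocity component across the vorticity is at most
`θ` on the vortex set) with `θ < 1`, vanishes on `t < 0`. [this file] -/
theorem typeI_ancient_eq_zero_of_crossFlow_lt_one_sim {C₀ θ : ℝ}
    {V : ℝ → EuclideanSpace ℝ (Fin 3) → EuclideanSpace ℝ (Fin 3)} (hθ : θ < 1)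
    (hV : IsTypeIAncientMild C₀ V) (hdec : HasTypeIDecay C₀ V)
    (hX : ∀ (s : ℝ) (y : EuclideanSpace ℝ (Fin 3)),
      ‖cross (lerayVorticity V s y) (lerayOrbit V s y)‖ ≤ θ * ‖lerayVorticity V s y‖) :
    ∀ t < 0, ∀ x, V t x = 0 :=
  typeI_ancient_eq_zero_of_lambProduct_lt_one_sim hθ hV hdec fun s y =>
    inner_lamb_le_of_crossFlow _ _ _ (hX s y)

/-- **The CROSS-FLOW FLOOR, CLASSICAL, physical variables, UNCONDITIONAL given the envelope.** A
KNSS-gauge Type-I field `V` at ANY Type-I level `C₀` (`IsTypeIAncientMild C₀ V`) with `HasTypeIDecay C₀ V`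
such that, at every `t < 0` and `x`, `√(−t)·‖ω(t,x) × V(t,x)‖ ≤ θ‖ω(t,x)‖` (`ω = curl V(t)`) with `θ < 1`,
vanishes on `t < 0`. Proof: the hypothesis is scale-covariant (`U = λV`, `Ω = λ²ω`, `λ = √(−t) = e^{−s/2}`:
both sides carry `λ²` after multiplication by `λ²`), so `typeI_ancient_eq_zero_of_crossFlow_lt_one_sim`
applies. Since `‖ω × V‖ ≤ ‖ω‖‖V‖`, this contains Row 2′ / the time-constant floor (`crossFlow_of_timeConstant`);
at `θ = 0` it is the endpoint «`V ∥ ω` on the vortex set». [this file; conditional statement — nothing asserts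
the hypothesis for a given field; nothing here bears on NS regularity] -/
theorem typeI_ancient_eq_zero_of_crossFlow_lt_one {C₀ θ : ℝ}
    {V : ℝ → EuclideanSpace ℝ (Fin 3) → EuclideanSpace ℝ (Fin 3)} (hθ : θ < 1)
    (hV : IsTypeIAncientMild C₀ V) (hdec : HasTypeIDecay C₀ V)
    (hX : ∀ t < 0, ∀ x,
      Real.sqrt (-t) * ‖cross (curl (V t) x) (V t x)‖ ≤ θ * ‖curl (V t) x‖) :
    ∀ t < 0, ∀ x, V t x = 0 := by
  refine typeI_ancient_eq_zero_of_crossFlow_lt_one_sim hθ hV hdec fun s y => ?_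
  have hl0 : 0 < Real.exp (-s / 2) := Real.exp_pos _
  have hk0 : 0 < Real.exp (-s) := Real.exp_pos _
  have ht0 : -Real.exp (-s) < 0 := neg_neg_of_pos hk0
  have hU : lerayOrbit V s y =
      Real.exp (-s / 2) • V (-Real.exp (-s)) (Real.exp (-s / 2) • y) := by
    rw [lerayOrbit_apply]
  have hΩ : lerayVorticity V s y =
      Real.exp (-s) • curl (V (-Real.exp (-s))) (Real.exp (-s / 2) • y) := by
    rw [lerayVorticity_apply, curl_lerayOrbit]
  have h := hX _ ht0 (Real.exp (-s / 2) • y)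
  rw [neg_neg, sqrt_exp_neg] at h
  set N : ℝ := ‖cross (curl (V (-Real.exp (-s))) (Real.exp (-s / 2) • y))
      (V (-Real.exp (-s)) (Real.exp (-s / 2) • y))‖ with hN
  set B : ℝ := ‖curl (V (-Real.exp (-s))) (Real.exp (-s / 2) • y)‖ with hB
  have eL : ‖cross (lerayVorticity V s y) (lerayOrbit V s y)‖ =
      Real.exp (-s) * (Real.exp (-s / 2) * N) := by
    rw [hU, hΩ, cross_smul_left, cross_smul_right, norm_smul, norm_smul,
      Real.norm_of_nonneg hk0.le, Real.norm_of_nonneg hl0.le]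
  have eR : ‖lerayVorticity V s y‖ = Real.exp (-s) * B := by
    rw [hΩ, norm_smul, Real.norm_of_nonneg hk0.le]
  rw [eL, eR]
  calc Real.exp (-s) * (Real.exp (-s / 2) * N)
      ≤ Real.exp (-s) * (θ * B) := mul_le_mul_of_nonneg_left h hk0.le
    _ = θ * (Real.exp (-s) * B) := by ring

/-- **Row 2′ ⊂ cross-flow floor**: the time-only constant bounds the cross-flow constant —
`√(−t)‖V‖ ≤ θ` gives `√(−t)‖ω × V‖ ≤ θ‖ω‖` (`‖ω × V‖ ≤ ‖ω‖‖V‖`). [folklore] -/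
theorem crossFlow_of_timeConstant {θ : ℝ}
    {V : ℝ → EuclideanSpace ℝ (Fin 3) → EuclideanSpace ℝ (Fin 3)}
    (hb : ∀ t < 0, ∀ x, Real.sqrt (-t) * ‖V t x‖ ≤ θ) :
    ∀ t < 0, ∀ x, Real.sqrt (-t) * ‖cross (curl (V t) x) (V t x)‖ ≤ θ * ‖curl (V t) x‖ := by
  intro t ht x
  calc Real.sqrt (-t) * ‖cross (curl (V t) x) (V t x)‖
      ≤ Real.sqrt (-t) * (‖curl (V t) x‖ * ‖V t x‖) :=
        mul_le_mul_of_nonneg_left (norm_cross_le_norm_mul_norm _ _) (Real.sqrt_nonneg _)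
    _ = (Real.sqrt (-t) * ‖V t x‖) * ‖curl (V t) x‖ := by ring
    _ ≤ θ * ‖curl (V t) x‖ := mul_le_mul_of_nonneg_right (hb t ht x) (norm_nonneg _)

/-- **Row 2′ re-derived through the cross-flow floor** (the exact statement of the tree's
`typeI_ancient_eq_zero_of_timeConstant_lt_one`, which stays the declaration of record — hence a kernel-checked
`example`, not a theorem): time-only constant `θ < 1` at any space–time level ⇒ `V ≡ 0`. [this file; bookkeeping] -/
example {C₀ θ : ℝ}
    {V : ℝ → EuclideanSpace ℝ (Fin 3) → EuclideanSpace ℝ (Fin 3)} (hθ : θ < 1)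
    (hV : IsTypeIAncientMild C₀ V) (hdec : HasTypeIDecay C₀ V)
    (hb : ∀ t < 0, ∀ x, Real.sqrt (-t) * ‖V t x‖ ≤ θ) :
    ∀ t < 0, ∀ x, V t x = 0 :=
  typeI_ancient_eq_zero_of_crossFlow_lt_one hθ hV hdec (crossFlow_of_timeConstant hb)

/-! ### The CLASS level -/

/-- **The CROSS-FLOW FLOOR at CLASS level, UNCONDITIONAL** (∀-representative shape of Row 2′'s
`rdssClass_empty_of_timeConstant` / T49's `rdssClass_empty_of_lambDirection`, with `‖V‖` replaced by the component
of `V` across `ω` on the vortex set; class C_H3 verbatim). For every space–time Type-I level `M` and every `θ < 1`: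
NO non-trivial member of the hypothesis class of `RdssProfileTruncation` (`1 < c`, `IsAncientMildSolution 1 u`,
measurable slices, `IsRotatedDSS c R u` with ANY twist `R ∈ O(3)`, `HasTypeIDecay M u`) has all its smooth KNSS
representatives (`IsTypeIAncientMild M V`, `V(t) = u(t)` a.e.) satisfying
`√(−t)·‖ω(t,x) × V(t,x)‖ ≤ θ·‖ω(t,x)‖` for all `t < 0` and all `x` (`ω = curl V(t)`). Portrait reading (an index,
never a gate): every survivor has, at every `M`, cross-flow constant `sup_{Ω ≠ 0} ‖U_⊥‖ ≥ 1` in similarity units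
(`U_⊥` the component of `U` perpendicular to `Ω`). Proof: a smooth representative exists
(`typeI_ancient_smoothRepresentative_ae`), carries `HasTypeIDecay M V`, and vanishes
(`typeI_ancient_eq_zero_of_crossFlow_lt_one`). DSS-blind. [this file; census words on ACCEPT, if any, are the
lead's; nothing numerical is asserted; no sharpness claimed; nothing here bears on NS regularity] -/
theorem rdssClass_empty_of_crossFlow (M : ℝ) {θ : ℝ} (hθ : θ < 1) :
    ¬ ∃ (c : ℝ) (R : (EuclideanSpace ℝ (Fin 3)) ≃ₗᵢ[ℝ] (EuclideanSpace ℝ (Fin 3)))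
        (u : ℝ → (EuclideanSpace ℝ (Fin 3)) → (EuclideanSpace ℝ (Fin 3))),
      1 < c ∧ IsAncientMildSolution 1 u ∧ (∀ t < 0, AEStronglyMeasurable (u t) volume) ∧
      IsRotatedDSS c R u ∧ HasTypeIDecay M u ∧
      (∀ V : ℝ → EuclideanSpace ℝ (Fin 3) → EuclideanSpace ℝ (Fin 3), IsTypeIAncientMild M V →
        (∀ t < 0, V t =ᵐ[volume] u t) →
        ∀ t < 0, ∀ x,
          Real.sqrt (-t) * ‖cross (curl (V t) x) (V t x)‖ ≤ θ * ‖curl (V t) x‖) ∧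
      ¬ (∀ t < 0, u t =ᵐ[volume] 0) := by
  rintro ⟨c, R, u, -, hmild, hmeas, -, hdec, hrep, hne⟩
  obtain ⟨V, hT, hdecV, hVu, -⟩ := typeI_ancient_smoothRepresentative_ae hmild hmeas hdec
  have hz : ∀ t < 0, ∀ x, V t x = 0 :=
    typeI_ancient_eq_zero_of_crossFlow_lt_one hθ hT hdecV (hrep V hT hVu)
  refine hne fun t ht => ?_
  have hVz : V t = 0 := funext fun x => by simpa using hz t ht x
  exact (hVu t ht).symm.trans (Filter.EventuallyEq.of_eq hVz)

end Summit.NavierStokesRegularity.NavierStokesRegularity.Theorems.SimilarityEnstrophy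

end
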